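import Summits.BirchSwinnertonDyer.Rank1Residual.Supersingular.BlindPointFlatTwo
import Literature.NumberTheory.EllipticCurves.PadicFormalLogOrder
import Literature.NumberTheory.EllipticCurves.QuadraticTwist
import Literature.NumberTheory.EllipticCurves.BSDRootNumberSmallConductorProofs
import Literature.NumberTheory.EllipticCurves.Rank1Residual.Predicates
import Literature.NumberTheory.EllipticCurves.GlobalMinimalModel
import HarnessLib

/-!
# Sketch42 — MEMO-an §42 (v2.01) typed candidates: the UNIT of the blind flat value at `ψ₂`
# modulo 8 is «algebraic BSD data × a 2-adic LOCAL residue of E», and the blind vanishing law.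

Setting as in `BlindFlatLogSquareAN52` (§40) / `BlindFlatSignAN53` (§41): `E/ℚ` good supersingular
at `2`, newform `f`, Sprung pair `(Ls, Lf)` at `2` (`IsSprungPair`), blind point `T = −2` (`ψ₂`, the
character of `ℚ(√2)`), odd-twist locus `w(E)·χ₈(N_E) = −1`, `W₂` a globally minimal model of the
twist `E^{(2)} = E ⊗ χ_{ℚ(√2)}` (conductor `64 N_E`). TREE units throughout (`θ_n = mazurTateElement`,
`plusPeriod = Ω_BSD` incl. `c_∞`), exactly as audited for AN52/AN53 (REF1 §368/§371).

THEORY (§42.1, the exact Sprung-`Log` dictionary at `ψ₂`, Sprung ANT 11 (2017) Def. of `Log_{a,N}`,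
`p = 2`): on the odd locus `(α⁴·L_α′(ψ₂), β⁴·L_β′(ψ₂)) = (b − α·s′, b − β·s′)` with
`b = evalAt (−2) Lf`, `s′ = derivAt (−2) Ls`; i.e. the stripped `D_cris`-valued leading term is
`b·ω − s′·φω`. A Perrin-Riou/Kobayashi-shaped p-adic BSD formula at `ψ₂` (Kobayashi, Invent. 191
(2013) Cor. 1.3(ii): `L′_{p,α} = (1−1/α)²·C(E)·h_α(P)`, `h_α` = height of the `α`-eigenline splitting)
then forces `b = κ₀ · BSDq(E^{(2)}) · log_ω(P₂)² / ⟨ω, φω⟩` — PURE `log²` divided by the Frobenius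
period `m₂₁ = ⟨ω, φω⟩` (`v₂(m₂₁) = 1`): hence `v₂(b) = q + 2ℓ` (P-an-40A), the mod-4 sign (P-an-41S),
a mod-8 residue that is a purely LOCAL invariant of `E/ℤ₂`, and NO local law mod 16 (odd squares are
`1` or `9 mod 16`). The census confirms all four (MEMO-an §42.3–42.5).

* `FlatBlindUnitAtChi8` (P-an-42A, `a₂ = ±2`): `unit(b) ≡ Tam(W₂)_odd · ((a₂/2)·(c₄(E)/8 + 1) + 2) (mod 8)`,
  `c₄(E)` of the minimal model (`c₄ ≡ 16 mod 32` automatically; only `c₄ mod 64 ∈ {16, 48}` matters).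
  Census: 619 certified rows (engine41 j340795/j340796, ≥ 3 certified unit bits, both signs of `Δ`) + 164
  (`Δ > 0`, engine cyc39 of -an g35, `n = 7`, disjoint labels), 0 violations (census42.md); refines the mod-4 law AN53.
* `FlatBlindUnitAtChi8Zero` (P-an-42B, `a₂ = 0`): `unit(b) ≡ Tam(W₂)_odd (mod 8)` if `Δ_min(E) ≡ 13 (16)`,
  `≡ 3·Tam(W₂)_odd (mod 8)` if `Δ_min(E) ≡ 5 (16)` (for `a₂ = 0` good-ss curves `Δ_min ≡ 5 mod 8` always).
  Census: mod 8 on 579 (engine41) + 147 (cyc39, `Δ > 0`) rows, mod 4 on 643 + 171 rows, 0 violations (census42.md). This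
  RESOLVES the «no sign law at a₂ = 0» negative of §41/REF1 §371 R371c (the driver `Δ_min mod 16` was
  not among the 13/21 drivers tested there).
* `FlatBlindVanishingAtChi8` (P-an-42V): on the odd locus, `r_an(E^{(2)}) ≠ 1` (i.e. `≥ 3`) forces BOTH
  coordinates of the `D`-valued leading term to vanish: `b = 0 ∧ s′ = 0` (p-adic Gross–Zagier shape;
  1 row of evidence: 7451a1 → 476864a1, `r_an = 3`, `b ≡ 0 (2⁵)`, `s′ ≡ 0 (2⁴)`; analytic twin of -imc S67-VAN).
-/

noncomputable section

open scoped Classical MatrixGroups ModularForm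

open WeierstrassCurve CongruenceSubgroup Literature.NumberTheory.EllipticCurves
  Literature.NumberTheory.EllipticCurves.ModularForms Literature.NumberTheory.EllipticCurves.Sprung2017
  Literature.NumberTheory.EllipticCurves.Rank1Residual
  Summit.BirchSwinnertonDyer.Rank1Residual.Supersingular
  Summit.BirchSwinnertonDyer.Rank1Residual.Supersingular.BlindLever

namespace Summit.BirchSwinnertonDyer.Cruxes.RankOneAtTwoBigImageOddLocal.BlindUnitAN54

/-- **P-an-42A `FlatBlindUnitAtChi8`** (MEMO-an §42): the UNIT LAW mod 8 of the blind flat value for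
`a₂(E) = ±2`. For `E/ℚ` good supersingular at `2` with `W.frobeniusTrace 2 ≠ 0` (`⇔ a₂ = ±2`,
REF1 K371.1), newform `f`, Sprung pair `(Ls, Lf)` at `2`, on the odd-twist locus
`w(E)·χ₈(N_E) = −1`, and a globally minimal model `W₂` of `E^{(2)}` of analytic rank `1`: writing
`evalAt (−2) Lf = u · 2ⁿ` (`u ∈ ℤ₂ˣ`; unique, vacuous iff the value is `0`), one has
`u ≡ Tam(W₂)_odd · ((a₂/2)·(c₄/8 + 1) + 2) (mod 8)` where `c₄ = c₄(integralModelInt W) ∈ ℤ`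
(`≡ 16 mod 32`, so `c₄/8` is exact) and `(m)_odd = m / 2^{v₂ m}`. Table: `(a₂, c₄ mod 64) =
(−2,16) ↦ 7·Tam_odd, (−2,48) ↦ 3·Tam_odd, (2,16) ↦ 5·Tam_odd, (2,48) ↦ Tam_odd`. Reduces mod 4 to AN53.
Census 783 certified rows (619 engine41 + 164 cyc39 `Δ>0`, two engines, both signs of `Δ`), 0 violations. [conjecture] -/
@[conjecture] def FlatBlindUnitAtChi8 : Prop :=
  ∀ (W : WeierstrassCurve ℚ) [W.IsElliptic] [W.IsGloballyMinimal] [NeZero (W.conductorNorm ℤ)]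
    (f : CuspForm (Gamma0 (W.conductorNorm ℤ)) 2),
    IsNewformOf W f → GoodSS W 2 → W.frobeniusTrace 2 ≠ 0 →
    W.rootNumber * ZMod.χ₈ (W.conductorNorm ℤ : ZMod 8) = -1 →
    ∀ (Ls Lf : IwasawaAlgebra 2), IsSprungPair f 2 (W.frobeniusTrace 2) Ls Lf →
    ∀ (W₂ : WeierstrassCurve ℚ) [W₂.IsElliptic] [W₂.IsGloballyMinimal],
      (∃ C : WeierstrassCurve.VariableChange ℚ, C • W.quadraticTwist 2 = W₂) →
      W₂.analyticRank = 1 →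
    ∀ (u : ℤ_[2]ˣ) (n : ℕ), evalAt (-2 : ℤ_[2]) Lf = (u : ℤ_[2]) * 2 ^ n →
      PadicInt.toZModPow 3 (u : ℤ_[2]) =
        ((W₂.tamagawaProduct / 2 ^ padicValNat 2 W₂.tamagawaProduct : ℕ) : ZMod (2 ^ 3)) *
          (((W.frobeniusTrace 2 / 2) * ((integralModelInt W).c₄ / 8 + 1) + 2 : ℤ) : ZMod (2 ^ 3))

/-- **P-an-42B `FlatBlindUnitAtChi8Zero`** (MEMO-an §42): the UNIT LAW mod 8 of the blind flat value
for `a₂(E) = 0`. Same setting with `W.frobeniusTrace 2 = 0`; writing `evalAt (−2) Lf = u · 2ⁿ`: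
`Δ_min(E) ≡ 13 (mod 16) ⇒ u ≡ Tam(W₂)_odd (mod 8)` and `Δ_min(E) ≡ 5 (mod 16) ⇒ u ≡ 3·Tam(W₂)_odd
(mod 8)`, `Δ_min = minimalDiscriminantInt W` (`Int.emod`, so `Δ < 0` is read correctly; for good-ss
`a₂ = 0` curves `Δ_min ≡ 5 mod 8`, the two cases are exhaustive). Census: mod 8 on 726 certified rows
(579 engine41 + 147 cyc39 `Δ>0`), mod 4 on 814, 0 violations; overturns «no sign law at a₂ = 0» (§41 / REF1
§371 R371c: `Δ_min mod 16` was not a tested driver). [conjecture] -/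
@[conjecture] def FlatBlindUnitAtChi8Zero : Prop :=
  ∀ (W : WeierstrassCurve ℚ) [W.IsElliptic] [W.IsGloballyMinimal] [NeZero (W.conductorNorm ℤ)]
    (f : CuspForm (Gamma0 (W.conductorNorm ℤ)) 2),
    IsNewformOf W f → GoodSS W 2 → W.frobeniusTrace 2 = 0 →
    W.rootNumber * ZMod.χ₈ (W.conductorNorm ℤ : ZMod 8) = -1 →
    ∀ (Ls Lf : IwasawaAlgebra 2), IsSprungPair f 2 (W.frobeniusTrace 2) Ls Lf →
    ∀ (W₂ : WeierstrassCurve ℚ) [W₂.IsElliptic] [W₂.IsGloballyMinimal],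
      (∃ C : WeierstrassCurve.VariableChange ℚ, C • W.quadraticTwist 2 = W₂) →
      W₂.analyticRank = 1 →
    ∀ (u : ℤ_[2]ˣ) (n : ℕ), evalAt (-2 : ℤ_[2]) Lf = (u : ℤ_[2]) * 2 ^ n →
      (minimalDiscriminantInt W % 16 = 13 →
        PadicInt.toZModPow 3 (u : ℤ_[2]) =
          ((W₂.tamagawaProduct / 2 ^ padicValNat 2 W₂.tamagawaProduct : ℕ) : ZMod (2 ^ 3))) ∧
      (minimalDiscriminantInt W % 16 = 5 →
        PadicInt.toZModPow 3 (u : ℤ_[2]) =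
          3 * ((W₂.tamagawaProduct / 2 ^ padicValNat 2 W₂.tamagawaProduct : ℕ) : ZMod (2 ^ 3)))

/-- **P-an-42V `FlatBlindVanishingAtChi8`** (MEMO-an §42): the BLIND VANISHING LAW. Same setting
without the rank hypothesis: on the odd-twist locus (where `r_an(E^{(2)})` is odd), if
`r_an(E^{(2)}) ≠ 1` then BOTH coordinates of the `D_cris`-valued leading term `b·ω − s′·φω` at `ψ₂`
vanish: `evalAt (−2) Lf = 0` and `derivAt (−2) Ls = 0` (`Ls(−2) = 0` itself is the tree theorem
`tsum_sharp_neg_two_eq_zero`). p-adic Gross–Zagier shape (Kobayashi 2013 Cor. 1.3(i) is the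
untwisted `p` odd analogue); 1 row of evidence (7451a1 → 476864a1, `r_an = 3`: `b ≡ 0 (2⁵)`,
`s′ ≡ 0 (2⁴)`); the converse direction is P-an-40A's non-vanishing at `r_an = 1`. [conjecture] -/
@[conjecture] def FlatBlindVanishingAtChi8 : Prop :=
  ∀ (W : WeierstrassCurve ℚ) [W.IsElliptic] [W.IsGloballyMinimal] [NeZero (W.conductorNorm ℤ)]
    (f : CuspForm (Gamma0 (W.conductorNorm ℤ)) 2),
    IsNewformOf W f → GoodSS W 2 →
    W.rootNumber * ZMod.χ₈ (W.conductorNorm ℤ : ZMod 8) = -1 →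
    ∀ (Ls Lf : IwasawaAlgebra 2), IsSprungPair f 2 (W.frobeniusTrace 2) Ls Lf →
    ∀ (W₂ : WeierstrassCurve ℚ) [W₂.IsElliptic] [W₂.IsGloballyMinimal],
      (∃ C : WeierstrassCurve.VariableChange ℚ, C • W.quadraticTwist 2 = W₂) →
      W₂.analyticRank ≠ 1 →
      evalAt (-2 : ℤ_[2]) Lf = 0 ∧ derivAt (-2 : ℤ_[2]) Ls = 0

/-- Kernel check of the closed form of P-an-42A against its 4-entry table (`a₂ = ±2`,
`c₄ mod 64 ∈ {16, 48}`): the residue `((a₂/2)·(c₄/8 + 1) + 2) mod 8`. [folklore] -/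
theorem unitTable_closedForm :
    (((-2 : ℤ) / 2) * ((16 : ℤ) / 8 + 1) + 2) % 8 = 7 ∧ (((-2 : ℤ) / 2) * ((48 : ℤ) / 8 + 1) + 2) % 8 = 3 ∧
    (((2 : ℤ) / 2) * ((16 : ℤ) / 8 + 1) + 2) % 8 = 5 ∧ (((2 : ℤ) / 2) * ((48 : ℤ) / 8 + 1) + 2) % 8 = 1 := by
  decide

/-- Mod-4 reduction of the closed form: for `a = ±2` and `c₄ ≡ 16 (mod 32)` the residue
`(a/2)·(c₄/8 + 1) + 2` is `≡ a/2 (mod 4)`, so P-an-42A refines the AN53 sign law. [folklore] -/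
theorem closedForm_mod_four (a c : ℤ) (ha : a = 2 ∨ a = -2) (hc : c % 32 = 16) :
    ((a / 2) * (c / 8 + 1) + 2) % 4 = (a / 2) % 4 := by
  have h8 : c / 8 % 4 = 2 := by omega
  rcases ha with rfl | rfl <;> omega

end Summit.BirchSwinnertonDyer.Cruxes.RankOneAtTwoBigImageOddLocal.BlindUnitAN54
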